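import Literature.RingTheory.Henselian.FiniteFlatHopfAlgebraUnitFactorHopf
import Literature.AlgebraicGeometry.GroupSchemes.HopfIdealClosedSubgroup
import Literature.AlgebraicGeometry.AbelianSchemes.AbelianSchemeLocalRelDim
import Mathlib.RingTheory.Localization.Away.Basic
import Mathlib.AlgebraicGeometry.Morphisms.ClosedImmersion
import HarnessLib

/-!
# The unit component of a finite group scheme over a henselian local ring — scheme dress of the unit Hopf factor
# ([Tate1997FiniteFlatGroupSchemes] (3.7) (I); [StacksProject] Tag 04GG)

Topic `Literature/AlgebraicGeometry/GroupSchemes`; namespace `Literature.AlgebraicGeometry.GroupSchemes`.  THEOREMS ONLY (no definition ∕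
instance ∕ notation ∕ named fact ∕ `sorry`).  Cell `pub/hodgecm-mathlib` (D-0151), FLOOR 0, P6 «MOD programme», sub-line P6b
`Cruxes/HLiu418/Lines/F0_P6b_ConnectedEtale.lean` ED. 1, stub `stub_b1a_unitComponent`, strategy σ1 «HOPF» (F0P6b-plan RE-DEAL 2026-09-01);
`--supports stmt-HodgeConjecture-24832`.  HC_CM is proved only modulo the printed citations until rung 0 closes; count-neutral generic algebraic
geometry.

THE PRINT.  [Tate1997FiniteFlatGroupSchemes] (3.7) (I) (`R` henselian local, `G = Spec A` finite over `R`): «`G⁰ = Spec (A⁰)`, the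
connected component of the identity, is the spectrum of the local factor `A⁰` of `A = ∏ Aᵢ` through which the counit factors; it is an
open and closed subgroup scheme of `G`».  [StacksProject] Tag 04GG (1)⇒(10): a finite algebra over a henselian local ring is a product of
local rings (the separating idempotents).  In the tree the ALGEBRA is ★: the unit idempotent `e` (★ `Henselian.exists_unit_idempotent`),
the HOPF IDEAL `(1 − e)` (★ `Henselian.isHopfIdeal_span_one_sub`, «`G⁰ G⁰ = G⁰`», `S(G⁰) = G⁰`), the LOCAL unit corner `B ⧸ (1 − e)`
(★ `Henselian.isLocalRing_unitCorner`), and the Hopf algebra `B = Γ(G, 𝒪_G)` of an affine group object with its points dictionary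
(★ `AffineGroupScheme.Alg`, `ptEquiv`, `ptMulEquiv`, p844646).  THIS FILE supplies the SCHEME-side clauses of `stub_b1a`:

* §1 GEOMETRY OF AN IDEMPOTENT (any commutative ring `B`, `e² = e`): `B ⧸ (1 − e)` is the localisation `B[e⁻¹]`
  (`isLocalizationAway_quotient_span_one_sub`, Mathlib `IsLocalization.away_of_isIdempotentElem`), so
  **`Spec (B ⧸ (1 − e)) → Spec B` is an OPEN immersion** (`isOpenImmersion_specMap_mk_span_one_sub`) as well as a CLOSED immersion
  (`isClosedImmersion_specMap_mk_span_one_sub`); and `Spec` of a local ring is connected (★ `Morphisms.connectedSpace_Spec_of_isLocalRing`),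
  whence **`connectedSpace_Spec_quotient_span_one_sub`** for the unit corner;
* §3 TRANSPORT: a scheme isomorphic to `Spec (B ⧸ (1 − e))` is connected when the corner is local (`connectedSpace_of_iso_Spec_quotient`);
* §2 (placed third) THE UNIT HOPF FACTOR OF `Γ(G, 𝒪_G)` (`R` henselian local, `G` a finite group object of `Over (Spec R)`):
  **`exists_unitIdempotent_alg`** — an idempotent `e ∈ Γ(G, 𝒪_G)` with `(1 − e)` a Hopf ideal, `Γ(G, 𝒪_G) ⧸ (1 − e)` local, `e ≡ 1 (mod 𝔫_ε)`;
* §4 HEADS **`exists_grpObj_isMonHom_quotIncl_unitIdempotent`** (explicit: the idempotent `e`, `G₀ = specOver R (Γ(G) ⧸ (1 − e))`,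
  `j =` ★ `AffineGroupScheme.quotIncl` a homomorphism — ★ `AffineGroupScheme.exists_grpObj_isMonHom_quotIncl`, «Hopf ideal ⇒ closed subgroup
  scheme» —, open, closed, connected source) and **`exists_unitComponent`** — `∃ (G₀ : Over (Spec R)) (_ : GrpObj G₀) (j : G₀ ⟶ G), IsMonHom j ∧
  IsOpenImmersion j.left ∧ IsClosedImmersion j.left ∧ ConnectedSpace G₀.left` (the text of the cell's `stub_b1a_unitComponent` with its predicate
  `IsUnitComponent` unfolded); `isFinite_and_flat_of_immersions` (`G₀` is finite, and flat when `G` is).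

## References
* [Tate1997FiniteFlatGroupSchemes] J. Tate, *Finite flat group schemes*, in: Modular Forms and Fermat's Last Theorem (1997), (3.7) (I)
  (pp. 138–139: `G⁰`, the connected component of the identity, open and closed subgroup scheme).
* [StacksProject] The Stacks Project, Tag 04GG ((1)⇒(10): finite algebras over a henselian local ring are products of local rings),
  Tag 00EC (spectrum of a local ring; idempotents and clopen subsets).
-/

set_option autoImplicit false

noncomputable section

universe u v

open CategoryTheory CategoryTheory.Limits AlgebraicGeometry IsLocalRing

namespace Literature.AlgebraicGeometry.GroupSchemes

/-! ## §1 Geometry of an idempotent: `Spec (B ⧸ (1 − e)) ↪ Spec B` is open and closed -/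

section Idempotent

variable {B : Type u} [CommRing B] {e : B}

/-- For an idempotent `e`, the quotient map `B → B ⧸ (1 − e)` is a LOCALISATION at `e` (`B ⧸ (1 − e) ≅ B[e⁻¹]`; Mathlib
`IsLocalization.away_of_isIdempotentElem`: kernel `(1 − e)`, surjective). [cite: StacksProject, Tag 00EC (idempotents ↔ open-and-closed subsets of `Spec`)] -/
theorem isLocalizationAway_quotient_span_one_sub (he : IsIdempotentElem e) :
    IsLocalization.Away e (B ⧸ Ideal.span {1 - e}) :=
  IsLocalization.away_of_isIdempotentElem he Ideal.mk_ker Ideal.Quotient.mk_surjective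

/-- **`Spec (B ⧸ (1 − e)) → Spec B` is an OPEN IMMERSION** for an idempotent `e` (it is the basic open `D(e)`).
[cite: StacksProject, Tag 00EC] [cite: Tate1997FiniteFlatGroupSchemes, (3.7) (I) («open and closed subgroup scheme»)] -/
theorem isOpenImmersion_specMap_mk_span_one_sub (he : IsIdempotentElem e) :
    IsOpenImmersion (Spec.map (CommRingCat.ofHom (Ideal.Quotient.mk (Ideal.span {1 - e})))) := by
  haveI := isLocalizationAway_quotient_span_one_sub he
  exact IsOpenImmersion.of_isLocalization (S := B ⧸ Ideal.span {1 - e}) e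

/-- `Spec (B ⧸ (1 − e)) → Spec B` is a CLOSED IMMERSION (a quotient map). [cite: StacksProject, Tag 00EC] -/
theorem isClosedImmersion_specMap_mk_span_one_sub (e : B) :
    IsClosedImmersion (Spec.map (CommRingCat.ofHom (Ideal.Quotient.mk (Ideal.span {1 - e})))) :=
  IsClosedImmersion.spec_of_surjective _ Ideal.Quotient.mk_surjective

/-- `Spec` of the (local) unit corner is CONNECTED. [cite: StacksProject, Tag 04GG] -/
theorem connectedSpace_Spec_quotient_span_one_sub (h : IsLocalRing (B ⧸ Ideal.span {1 - e})) :
    ConnectedSpace ↥(Spec (.of (B ⧸ Ideal.span {1 - e}))) :=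
  Literature.AlgebraicGeometry.Morphisms.connectedSpace_Spec_of_isLocalRing _

end Idempotent

/-! ## §3 Transport: a scheme isomorphic to `Spec` of the (local) unit corner is connected -/

section Transport

variable {B : Type u} [CommRing B] {e : B}

/-- **A scheme isomorphic to `Spec (B ⧸ (1 − e))` is CONNECTED** when the corner `B ⧸ (1 − e)` is local. [cite: StacksProject, Tag 04GG] -/
theorem connectedSpace_of_iso_Spec_quotient {Y : Scheme.{u}} (iY : Y ≅ Spec (.of (B ⧸ Ideal.span {1 - e})))
    (h : IsLocalRing (B ⧸ Ideal.span {1 - e})) : ConnectedSpace ↥Y := by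
  haveI := connectedSpace_Spec_quotient_span_one_sub h
  exact (Scheme.homeoOfIso iY).symm.surjective.connectedSpace (Scheme.homeoOfIso iY).symm.continuous

end Transport

/-! ## §2 The unit Hopf factor of `Γ(G, 𝒪_G)` for a finite group scheme over a henselian local ring -/

section UnitFactor

open Literature.RingTheory.Henselian

variable {R : Type u} [CommRing R] [HenselianLocalRing R] (G : Over (Spec (.of R))) [GrpObj G] [IsAffine G.left]
  [IsFinite G.hom]

/-- **The unit Hopf factor of `Γ(G, 𝒪_G)`** ([Tate1997FiniteFlatGroupSchemes] (3.7) (I), «`A⁰`»): for a FINITE (affine) group object `G`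
of `Over (Spec R)` over a HENSELIAN local ring there is an idempotent `e ∈ B = Γ(G, 𝒪_G)` (★ `AffineGroupScheme.Alg`, a module-finite
commutative Hopf `R`-algebra, ★ p844646) with `e ≡ 1` modulo the unit maximal ideal `𝔫_ε`, `e ∈ 𝔫` for every other maximal ideal,
`(1 − e)` a HOPF IDEAL (★ `Henselian.isHopfIdeal_span_one_sub`) and `B ⧸ (1 − e)` LOCAL (★ `Henselian.isLocalRing_unitCorner`).  No
flatness is used. [cite: Tate1997FiniteFlatGroupSchemes, (3.7) (I) (p. 141)] [cite: StacksProject, Tag 04GG] -/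
theorem exists_unitIdempotent_alg :
    ∃ e : AffineGroupScheme.Alg G, IsIdempotentElem e ∧
      e - 1 ∈ RingHom.ker ((residue R).comp (Bialgebra.counitAlgHom R (AffineGroupScheme.Alg G) : _ →+* R)) ∧
      (∀ 𝔫 : Ideal (AffineGroupScheme.Alg G), 𝔫.IsMaximal →
        𝔫 ≠ RingHom.ker ((residue R).comp (Bialgebra.counitAlgHom R (AffineGroupScheme.Alg G) : _ →+* R)) → e ∈ 𝔫) ∧
      (Ideal.span {1 - e}).IsHopfIdeal R ∧ IsLocalRing (AffineGroupScheme.Alg G ⧸ Ideal.span {1 - e}) := by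
  haveI : Module.Finite R (AffineGroupScheme.Alg G) := AffineGroupScheme.Alg.moduleFinite G
  obtain ⟨e, he, he1, he0⟩ := exists_unit_idempotent (R := R) (B := AffineGroupScheme.Alg G)
  exact ⟨e, he, he1, he0, isHopfIdeal_span_one_sub (R := R) he he1 he0, (isLocalRing_unitCorner (R := R) he1 he0).1⟩

end UnitFactor

/-! ## §4 HEAD — the unit component `G⁰ = Spec (Γ(G) ⧸ (1 − e)) ↪ G` of a finite group scheme over a henselian local ring -/

section Head

open Literature.AlgebraicGeometry.Motives

variable (R : Type u) [CommRing R] [HenselianLocalRing R] (G : Over (Spec (.of R))) [GrpObj G] [IsAffine G.left] [IsFinite G.hom]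

/-- **THE UNIT COMPONENT, EXPLICIT FORM** ([Tate1997FiniteFlatGroupSchemes] (3.7) (I): `G⁰ = Spec A⁰`): for a finite (affine) group object
`G` of `Over (Spec R)`, `R` henselian local, there is an idempotent `e ∈ A = Γ(G, 𝒪_G)` — `e ≡ 1 (mod 𝔫_ε)`, `e ∈ 𝔫` for every other
maximal `𝔫`, `(1 − e)` a Hopf ideal, `A ⧸ (1 − e)` local (§2) — such that `G₀ := Spec (A ⧸ (1 − e))` (★ `specOver`) carries a group-object
structure for which the inclusion `j = ` ★ `AffineGroupScheme.quotIncl G (1 − e)` (`Spec (A ↠ A ⧸ (1 − e))` followed by `Spec A ≅ G`) is a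
HOMOMORPHISM and an OPEN AND CLOSED IMMERSION with CONNECTED source.  This form names the corner, so that the kernel-of-reduction and rank
statements of the unit corner (★ `Henselian/FiniteFlatHopfAlgebraUnitFactor*`) can be read on `G₀`.
[cite: Tate1997FiniteFlatGroupSchemes, (3.7) (I) (p. 141)] [cite: StacksProject, Tag 04GG] -/
theorem exists_grpObj_isMonHom_quotIncl_unitIdempotent :
    ∃ e : AffineGroupScheme.Alg G, IsIdempotentElem e ∧
      e - 1 ∈ RingHom.ker ((residue R).comp (Bialgebra.counitAlgHom R (AffineGroupScheme.Alg G) : _ →+* R)) ∧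
      (∀ 𝔫 : Ideal (AffineGroupScheme.Alg G), 𝔫.IsMaximal →
        𝔫 ≠ RingHom.ker ((residue R).comp (Bialgebra.counitAlgHom R (AffineGroupScheme.Alg G) : _ →+* R)) → e ∈ 𝔫) ∧
      (Ideal.span {1 - e}).IsHopfIdeal R ∧ IsLocalRing (AffineGroupScheme.Alg G ⧸ Ideal.span {1 - e}) ∧
      ∃ GZ : GrpObj (specOver R (AffineGroupScheme.Alg G ⧸ Ideal.span {1 - e})),
        (letI := GZ; IsMonHom (AffineGroupScheme.quotIncl G (Ideal.span {1 - e}))) ∧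
        IsOpenImmersion (AffineGroupScheme.quotIncl G (Ideal.span {1 - e})).left ∧
        IsClosedImmersion (AffineGroupScheme.quotIncl G (Ideal.span {1 - e})).left ∧
        ConnectedSpace ↥(specOver R (AffineGroupScheme.Alg G ⧸ Ideal.span {1 - e})).left := by
  obtain ⟨e, he, he1, he0, hI, hloc⟩ := exists_unitIdempotent_alg G
  haveI := hI
  obtain ⟨GZ, hj⟩ := AffineGroupScheme.exists_grpObj_isMonHom_quotIncl G (Ideal.span {1 - e})
  refine ⟨e, he, he1, he0, hI, hloc, GZ, hj, ?_, ?_, ?_⟩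
  · rw [AffineGroupScheme.quotIncl_left]
    exact MorphismProperty.comp_mem _ _ _ (isOpenImmersion_specMap_mk_span_one_sub he) inferInstance
  · exact AffineGroupScheme.isClosedImmersion_quotIncl_left G (Ideal.span {1 - e})
  · exact connectedSpace_of_iso_Spec_quotient (Iso.refl _) hloc

omit [IsAffine G.left] in
/-- **THE UNIT COMPONENT ([Tate1997FiniteFlatGroupSchemes] (3.7) (I)).**  A FINITE group scheme `G` over a HENSELIAN local ring `R`
(a group object of `Over (Spec R)` with `G → Spec R` finite; flatness is not needed) has a unit component: a group object `G₀` with a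
HOMOMORPHISM `j : G₀ ⟶ G` whose underlying morphism is an OPEN AND CLOSED IMMERSION with CONNECTED source — namely
`G₀ = Spec (Γ(G, 𝒪_G) ⧸ (1 − e))` for the unit idempotent `e` (§2), embedded by ★ `AffineGroupScheme.quotIncl` (a homomorphic closed
immersion because `(1 − e)` is a Hopf ideal, ★ `AffineGroupScheme.exists_grpObj_isMonHom_quotIncl`), open because `e` is idempotent (§1, §3)
and connected because the unit corner is local.  This is the text of `stub_b1a_unitComponent` of the cell's line
`Cruxes/HLiu418/Lines/F0_P6b_ConnectedEtale.lean` (predicate `IsUnitComponent G G₀ j` unfolded).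
[cite: Tate1997FiniteFlatGroupSchemes, (3.7) (I) (p. 141)] [cite: StacksProject, Tag 04GG] -/
theorem exists_unitComponent :
    ∃ (G₀ : Over (Spec (.of R))) (_ : GrpObj G₀) (j : G₀ ⟶ G),
      IsMonHom j ∧ IsOpenImmersion j.left ∧ IsClosedImmersion j.left ∧ ConnectedSpace ↥G₀.left := by
  haveI : IsAffine G.left := AffineGroupScheme.isAffine_left_of_isAffineHom G
  obtain ⟨e, -, -, -, -, -, GZ, hj, ho, hc, hconn⟩ := exists_grpObj_isMonHom_quotIncl_unitIdempotent R G
  exact ⟨_, GZ, _, hj, ho, hc, hconn⟩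

end Head

section FiniteFlat

/-- **The unit component is FINITE over the base, and FLAT when `G` is**: for any `j : G₀ ⟶ G` over a base `S` which is a closed and
open immersion into a finite (resp. finite flat) `G → S`, `G₀ → S` is finite (resp. flat) — so `G⁰` of (3.7) (I) is a finite flat group
scheme whenever `G` is. [cite: Tate1997FiniteFlatGroupSchemes, (3.7) (I) («`G⁰` is a flat closed … subgroup scheme»)] -/
theorem isFinite_and_flat_of_immersions {S : Scheme.{u}} {G₀ G : Over S} (j : G₀ ⟶ G) [IsClosedImmersion j.left]
    [IsOpenImmersion j.left] [IsFinite G.hom] : IsFinite G₀.hom ∧ (Flat G.hom → Flat G₀.hom) := by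
  have hw : j.left ≫ G.hom = G₀.hom := Over.w j
  refine ⟨?_, fun hfl => ?_⟩
  · rw [← hw]; infer_instance
  · rw [← hw]; infer_instance

end FiniteFlat




end Literature.AlgebraicGeometry.GroupSchemes

end
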